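import Summits.ResolutionOfSingularities.ResolutionOfSingularities.Theorems.EquisingularLiftEquisingularLiftNatSpecimenS10
import Summits.ResolutionOfSingularities.ResolutionOfSingularities.Theorems.EquisingularLiftEquisingularLiftNatSpecimenM5Germs
import HarnessLib

/-!
# [OURS · L1 W4.5(b) · EL♮(3) · WIDTH row iso-w3, desk R39 D3-6 «S10 kernel specimen»] S10 CHART ANCHORS: the strict transforms of
# `S10 = (x² + y²z)² + x⁵ + z⁶ + xy⁸ + x¹⁰ + y¹⁰ + z¹⁰` in the blow-up charts P.y / E1.x / Ephi.z / Eq1.y, and the curves along which they are singular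

OURS · L1 W4.5(b) · EL♮(3) stmt-ResolutionOfSingularities-20148 · counted 0 · AI-written (res-L1-w45b-iso-w3 g0), weaker than expert review; nothing of
[Hironaka2017] asserted; no statement of the manuscript. Sorry-free, standard axioms, no instance, no notation, def-light (four `def`s = the four strict
transforms, so that later files can name them). `--supports stmt-ResolutionOfSingularities-20148 --as helper`.

WHAT (res-L1-w45b-lead-1 memo `RESIDUE-CUSTOMER-S10.md` 8a0e274662a4bc2a §1 (S1)–(S4) and §5 chart Eq1.y, kernel anchor ✓ p647027 `specimenS10`):
polynomial identities over EVERY field `k` (they hold over `ℤ`), each of the shape «chart pull-back of the previous equation = (exceptional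
equation)^multiplicity · (new equation)», plus an explicit decomposition of each new equation in the SQUARE of the ideal of a curve, whence the
Jacobian statement «the equation and all its partial derivatives vanish along that curve»:
* P.y (point blow-up of `x₀ = 0`, chart `x = x₁y₁, y = y₁, z = z₁y₁`, exceptional `y₁`, multiplicity 4): `s10F1 = (x₁² + y₁z₁)² + x₁⁵y₁ + z₁⁶y₁² + x₁y₁⁵
  + y₁⁶(x₁¹⁰ + 1 + z₁¹⁰)` (`aeval_chartPy_specimenS10`); `s10F1 ∈ (x₁, y₁)²` — `H₁` is singular along the line `L = {x₁ = y₁ = 0}` (S1); its tangent cone at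
  `q = 0` is the DOUBLE quadric cone: `initialForm (1,1,1) s10F1 = (x₁² + y₁z₁)²`, and `s10F1` is NOT locally Newton-nondegenerate (torus point `(1,1,−1)`) (S2);
* E1.x (blow-up of `L`, chart `x₁ = x, y₁ = yx, z₁ = z`, exceptional `x`, multiplicity 2): `s10F2 = (x + yz)² + x⁴y + y²z⁶ + x⁴y⁵ + x⁴y⁶(x¹⁰ + 1 + z¹⁰)`
  (`aeval_chartE1x_s10F1`); `s10F2 ∈ (x, z)²` — `T₂` is singular along the fibre `φ_q = {x = z = 0}` (S3);
* Ephi.z (blow-up of `φ_q`, chart `x = x′z`, exceptional `z`, multiplicity 2): `s10F3 = (x′ + y)² + z²·(x′⁴y + y²z² + x′⁴y⁵ + x′⁴y⁶(x′¹⁰z¹⁰ + 1 + z¹⁰))`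
  (`aeval_chartEphiz_s10F2`); `s10F3 ∈ (z, x′ + y)²` — `T₃` is singular along the NON-CONSTANT section `σ∗ = {z = 0, x′ = −y}` (S4);
* Eq1.y (the `k ≥ 1` branch: point blow-up at `q`, chart `x₁ = xy, y₁ = y, z₁ = zy`, exceptional `y`, multiplicity 4): `s10Fq = (x² + z)² + x⁵y² + z⁶y⁴ + xy²
  + y² + x¹⁰y¹² + z¹⁰y¹²` (`aeval_chartEq1y_s10F1`); `s10Fq ∈ (y, x² + z)²` — `Bl_q H₁` is singular along the CONIC `Γ_q = {y = 0, x² + z = 0}` (§5).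
Variables: `X 0, X 1, X 2` = the chart coordinates in the order written above.
HONEST SCOPE: identities and ideal memberships only. NOT claimed here: that these curves are the WHOLE singular locus, the multiplicities as orders of
vanishing, any E1 / member bookkeeping, the deaths of §2 (memo-level readings of the typed menus), isolatedness, or anything scheme-level. Dim-3 char-p
resolution is a theorem in print (Cossart–Piltant 2008/2009); this is OUR kernel-own specimen bookkeeping, counted 0.
-/

noncomputable section

set_option linter.dupNamespace false

open MvPolynomial

namespace Summit.ResolutionOfSingularities.ResolutionOfSingularities.Cruxes.EquisingularLiftNat.Sections

variable (k : Type) [Field k]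

/-! ## The four strict transforms -/

/-- Chart P.y of the point blow-up: the strict transform `F₁` of `S10` (memo §1). [OURS · L1 W4.5b · specimen object] -/
def s10F1 : MvPolynomial (Fin 3) k :=
  (X 0 ^ 2 + X 1 * X 2) ^ 2 + X 0 ^ 5 * X 1 + X 2 ^ 6 * X 1 ^ 2 + X 0 * X 1 ^ 5 + X 1 ^ 6 * (X 0 ^ 10 + 1 + X 2 ^ 10)

/-- Chart E1.x of the blow-up of the line `L`: the strict transform `F₂` (memo §1 (S3)). [OURS · L1 W4.5b · specimen object] -/
def s10F2 : MvPolynomial (Fin 3) k :=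
  (X 0 + X 1 * X 2) ^ 2 + X 0 ^ 4 * X 1 + X 1 ^ 2 * X 2 ^ 6 + X 0 ^ 4 * X 1 ^ 5 + X 0 ^ 4 * X 1 ^ 6 * (X 0 ^ 10 + 1 + X 2 ^ 10)

/-- Chart Ephi.z of the blow-up of the fibre `φ_q`: the strict transform `F₃` (memo §1 (S4)). [OURS · L1 W4.5b · specimen object] -/
def s10F3 : MvPolynomial (Fin 3) k :=
  (X 0 + X 1) ^ 2 + X 2 ^ 2 * (X 0 ^ 4 * X 1 + X 1 ^ 2 * X 2 ^ 2 + X 0 ^ 4 * X 1 ^ 5 + X 0 ^ 4 * X 1 ^ 6 * (X 0 ^ 10 * X 2 ^ 10 + 1 + X 2 ^ 10))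

/-- Chart Eq1.y of the point blow-up at `q` (the `k ≥ 1` branch): the strict transform `F_q` (memo §5). [OURS · L1 W4.5b · specimen object] -/
def s10Fq : MvPolynomial (Fin 3) k :=
  (X 0 ^ 2 + X 2) ^ 2 + X 0 ^ 5 * X 1 ^ 2 + X 2 ^ 6 * X 1 ^ 4 + X 0 * X 1 ^ 2 + X 1 ^ 2 + X 0 ^ 10 * X 1 ^ 12 + X 2 ^ 10 * X 1 ^ 12

variable {k}

/-! ## A. Chart identities (pull-back = exceptional^multiplicity · strict transform) -/

/-- **P.y**: `S10(x₁y₁, y₁, z₁y₁) = y₁⁴ · F₁`. [OURS · L1 W4.5b] -/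
theorem aeval_chartPy_specimenS10 :
    aeval ![X 0 * X 1, X 1, X 2 * X 1] (specimenS10 k) = X 1 ^ 4 * s10F1 k := by
  simp only [specimenS10, s10F1, map_add, map_mul, map_pow, aeval_X, Matrix.cons_val_zero, Matrix.cons_val_one, Matrix.head_cons,
    Matrix.cons_val_two, Matrix.tail_cons]
  ring

/-- **E1.x**: `F₁(x, yx, z) = x² · F₂`. [OURS · L1 W4.5b] -/
theorem aeval_chartE1x_s10F1 :
    aeval ![X 0, X 1 * X 0, X 2] (s10F1 k) = X 0 ^ 2 * s10F2 k := by
  simp only [s10F1, s10F2, map_add, map_mul, map_pow, map_one, aeval_X, Matrix.cons_val_zero, Matrix.cons_val_one, Matrix.head_cons,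
    Matrix.cons_val_two, Matrix.tail_cons]
  ring

/-- **Ephi.z**: `F₂(x′z, y, z) = z² · F₃`. [OURS · L1 W4.5b] -/
theorem aeval_chartEphiz_s10F2 :
    aeval ![X 0 * X 2, X 1, X 2] (s10F2 k) = X 2 ^ 2 * s10F3 k := by
  simp only [s10F2, s10F3, map_add, map_mul, map_pow, map_one, aeval_X, Matrix.cons_val_zero, Matrix.cons_val_one, Matrix.head_cons,
    Matrix.cons_val_two, Matrix.tail_cons]
  ring

/-- **Eq1.y**: `F₁(xy, y, zy) = y⁴ · F_q`. [OURS · L1 W4.5b] -/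
theorem aeval_chartEq1y_s10F1 :
    aeval ![X 0 * X 1, X 1, X 2 * X 1] (s10F1 k) = X 1 ^ 4 * s10Fq k := by
  simp only [s10F1, s10Fq, map_add, map_mul, map_pow, map_one, aeval_X, Matrix.cons_val_zero, Matrix.cons_val_one, Matrix.head_cons,
    Matrix.cons_val_two, Matrix.tail_cons]
  ring

/-! ## B. Singular along a curve: square-ideal decompositions and the Jacobian corollary -/

/-- A decomposition `F = A·a² + B·(a·b) + C·b²` puts `F` in the square of the ideal `(a, b)`. [OURS · L1 W4.5b · small print] -/
theorem mem_sq_span_pair_of_decomp {R : Type} [CommRing R] {F a b A B C : R} (h : F = A * a ^ 2 + B * (a * b) + C * b ^ 2) :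
    F ∈ (Ideal.span {a, b} : Ideal R) ^ 2 := by
  have ha : a ∈ (Ideal.span {a, b} : Ideal R) := Ideal.subset_span (by simp)
  have hb : b ∈ (Ideal.span {a, b} : Ideal R) := Ideal.subset_span (by simp)
  rw [h, sq]
  refine Ideal.add_mem _ (Ideal.add_mem _ ?_ ?_) ?_
  · rw [sq]; exact Ideal.mul_mem_left _ _ (Ideal.mul_mem_mul ha ha)
  · exact Ideal.mul_mem_left _ _ (Ideal.mul_mem_mul ha hb)
  · rw [sq]; exact Ideal.mul_mem_left _ _ (Ideal.mul_mem_mul hb hb)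

/-- **Jacobian form**: with `F = A·a² + B·(a·b) + C·b²`, the polynomial `F` and ALL its partial derivatives vanish at every point where `a` and `b` vanish
(`V(F)` is singular along `{a = b = 0}`). [OURS · L1 W4.5b · small print] -/
theorem eval_and_pderiv_eq_zero_of_decomp {N : ℕ} {F a b A B C : MvPolynomial (Fin N) k} (h : F = A * a ^ 2 + B * (a * b) + C * b ^ 2)
    (v : Fin N → k) (ha : eval v a = 0) (hb : eval v b = 0) :
    eval v F = 0 ∧ ∀ i, eval v (pderiv i F) = 0 := by
  refine ⟨?_, fun i => ?_⟩
  · rw [h]; simp [ha, hb]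
  · rw [h]
    simp only [map_add, Derivation.leibniz, sq, smul_eq_mul, map_mul, ha, hb, mul_zero, zero_mul, add_zero]

/-- (S1) `F₁ = A·x₁² + B·x₁y₁ + C·y₁²` explicitly. [OURS · L1 W4.5b] -/
theorem s10F1_decomp : s10F1 k = (X 0 ^ 2 + 2 * X 1 * X 2 + X 0 ^ 3 * X 1 + X 0 ^ 8 * X 1 ^ 6) * X 0 ^ 2 + X 1 ^ 4 * (X 0 * X 1) +
    (X 2 ^ 2 + X 2 ^ 6 + X 1 ^ 4 + X 1 ^ 4 * X 2 ^ 10) * X 1 ^ 2 := by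
  simp only [s10F1]; ring

/-- **(S1) `F₁ ∈ (x₁, y₁)²`**: `H₁ = Bl_{x₀} S10` is singular along the whole line `L = S ∩ St Π = {x₁ = y₁ = 0}`. [OURS · L1 W4.5b] -/
theorem s10F1_mem_sq : s10F1 k ∈ (Ideal.span {(X 0 : MvPolynomial (Fin 3) k), X 1}) ^ 2 :=
  mem_sq_span_pair_of_decomp s10F1_decomp

/-- (S1), Jacobian form: `F₁` and `∇F₁` vanish at every point of `L`. [OURS · L1 W4.5b] -/
theorem s10F1_singular_along_L (v : Fin 3 → k) (h0 : v 0 = 0) (h1 : v 1 = 0) :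
    eval v (s10F1 k) = 0 ∧ ∀ i, eval v (pderiv i (s10F1 k)) = 0 :=
  eval_and_pderiv_eq_zero_of_decomp s10F1_decomp v (by simp [h0]) (by simp [h1])

/-- (S3) `F₂ = A·x² + B·xz + C·z²` explicitly. [OURS · L1 W4.5b] -/
theorem s10F2_decomp : s10F2 k = (1 + X 0 ^ 2 * (X 1 + X 1 ^ 5 + X 1 ^ 6 * (X 0 ^ 10 + 1 + X 2 ^ 10))) * X 0 ^ 2 + (2 * X 1) * (X 0 * X 2) +
    (X 1 ^ 2 + X 1 ^ 2 * X 2 ^ 4) * X 2 ^ 2 := by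
  simp only [s10F2]; ring

/-- **(S3) `F₂ ∈ (x, z)²`**: after the carrier blow-up `Bl_L`, `T₂` is singular along the whole fibre `φ_q = E₁|_q = {x = z = 0}`. [OURS · L1 W4.5b] -/
theorem s10F2_mem_sq : s10F2 k ∈ (Ideal.span {(X 0 : MvPolynomial (Fin 3) k), X 2}) ^ 2 :=
  mem_sq_span_pair_of_decomp s10F2_decomp

/-- (S3), Jacobian form: `F₂` and `∇F₂` vanish at every point of `φ_q`. [OURS · L1 W4.5b] -/
theorem s10F2_singular_along_phi (v : Fin 3 → k) (h0 : v 0 = 0) (h2 : v 2 = 0) :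
    eval v (s10F2 k) = 0 ∧ ∀ i, eval v (pderiv i (s10F2 k)) = 0 :=
  eval_and_pderiv_eq_zero_of_decomp s10F2_decomp v (by simp [h0]) (by simp [h2])

/-- (S4) `F₃ = C·(x′ + y)² + A·z²` explicitly (`B = 0`). [OURS · L1 W4.5b] -/
theorem s10F3_decomp : s10F3 k = (X 0 ^ 4 * X 1 + X 1 ^ 2 * X 2 ^ 2 + X 0 ^ 4 * X 1 ^ 5 + X 0 ^ 4 * X 1 ^ 6 * (X 0 ^ 10 * X 2 ^ 10 + 1 + X 2 ^ 10)) * X 2 ^ 2 +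
    0 * (X 2 * (X 0 + X 1)) + 1 * (X 0 + X 1) ^ 2 := by
  simp only [s10F3]; ring

/-- **(S4) `F₃ ∈ (z, x′ + y)²`**: after the pair round `Bl_{φ_q}`, `T₃` is singular along the non-constant section `σ∗ = {z = 0, x′ = −y}` of `E_φ → φ_q`.
[OURS · L1 W4.5b] -/
theorem s10F3_mem_sq : s10F3 k ∈ (Ideal.span {(X 2 : MvPolynomial (Fin 3) k), X 0 + X 1}) ^ 2 :=
  mem_sq_span_pair_of_decomp s10F3_decomp

/-- (S4), Jacobian form: `F₃` and `∇F₃` vanish at every point of `σ∗`. [OURS · L1 W4.5b] -/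
theorem s10F3_singular_along_sigma (v : Fin 3 → k) (h2 : v 2 = 0) (h01 : v 0 + v 1 = 0) :
    eval v (s10F3 k) = 0 ∧ ∀ i, eval v (pderiv i (s10F3 k)) = 0 :=
  eval_and_pderiv_eq_zero_of_decomp s10F3_decomp v (by simp [h2]) (by simp [h01])

/-- (§5, branch `k ≥ 1`) `F_q = C·(x² + z)² + A·y²` explicitly (`B = 0`). [OURS · L1 W4.5b] -/
theorem s10Fq_decomp : s10Fq k = (X 0 ^ 5 + X 2 ^ 6 * X 1 ^ 2 + X 0 + 1 + X 0 ^ 10 * X 1 ^ 10 + X 2 ^ 10 * X 1 ^ 10) * X 1 ^ 2 +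
    0 * (X 1 * (X 0 ^ 2 + X 2)) + 1 * (X 0 ^ 2 + X 2) ^ 2 := by
  simp only [s10Fq]; ring

/-- **(§5) `F_q ∈ (y, x² + z)²`**: `Bl_q H₁` is singular along the whole CONIC `Γ_q = {y = 0, x² + z = 0}` of `E_q` (every `k_q ≥ 1` branch meets it).
[OURS · L1 W4.5b] -/
theorem s10Fq_mem_sq : s10Fq k ∈ (Ideal.span {(X 1 : MvPolynomial (Fin 3) k), X 0 ^ 2 + X 2}) ^ 2 :=
  mem_sq_span_pair_of_decomp s10Fq_decomp

/-- (§5), Jacobian form: `F_q` and `∇F_q` vanish at every point of `Γ_q`. [OURS · L1 W4.5b] -/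
theorem s10Fq_singular_along_conic (v : Fin 3 → k) (h1 : v 1 = 0) (h02 : v 0 ^ 2 + v 2 = 0) :
    eval v (s10Fq k) = 0 ∧ ∀ i, eval v (pderiv i (s10Fq k)) = 0 :=
  eval_and_pderiv_eq_zero_of_decomp s10Fq_decomp v (by simp [h1]) (by simp [h02])

/-! ## C. (S2) The germ of `H₁` at `q`: double quadric-cone tangent cone, not locally Newton-nondegenerate -/

/-- (S2) **The tangent cone of `H₁` at `q` is the DOUBLE quadric cone**: the initial form of `F₁` for the weight `(1,1,1)` is `(x₁² + y₁z₁)²` (the rest of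
`F₁` has degree `≥ 6`). [OURS · L1 W4.5b] -/
theorem initialForm_ones_s10F1 : initialForm ![(1 : ℤ), 1, 1] (s10F1 k) = (X 0 ^ 2 + X 1 * X 2) ^ 2 := by
  have hX : ∀ i : Fin 3, IsWeightedHomogeneous ![(1 : ℤ), 1, 1] (X i : MvPolynomial (Fin 3) k) (![(1 : ℤ), 1, 1] i) :=
    fun i => isWeightedHomogeneous_X k _ i
  have hP : IsWeightedHomogeneous ![(1 : ℤ), 1, 1] ((X 0 ^ 2 + X 1 * X 2) ^ 2 : MvPolynomial (Fin 3) k) 4 :=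
    isWeightedHomogeneous_of_eq (((isWeightedHomogeneous_of_eq ((hX 0).pow 2) (show _ = (2 : ℤ) by simp)).add
      (isWeightedHomogeneous_of_eq ((hX 1).mul (hX 2)) (show _ = (2 : ℤ) by simp))).pow 2) (by simp)
  have hR : ∀ d, coeff d (X 0 ^ 5 * X 1 + X 2 ^ 6 * X 1 ^ 2 + X 0 * X 1 ^ 5 + X 1 ^ 6 * X 0 ^ 10 + X 1 ^ 6 + X 1 ^ 6 * X 2 ^ 10 :
      MvPolynomial (Fin 3) k) ≠ 0 → (4 : ℤ) < Finsupp.weight ![(1 : ℤ), 1, 1] d :=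
    lt_weight_add (lt_weight_add (lt_weight_add (lt_weight_add (lt_weight_add
      (lt_weight_of_isWeightedHomogeneous (isWeightedHomogeneous_of_eq (((hX 0).pow 5).mul (hX 1)) (show _ = (6 : ℤ) by simp)) (by norm_num))
      (lt_weight_of_isWeightedHomogeneous (isWeightedHomogeneous_of_eq (((hX 2).pow 6).mul ((hX 1).pow 2)) (show _ = (8 : ℤ) by simp)) (by norm_num)))
      (lt_weight_of_isWeightedHomogeneous (isWeightedHomogeneous_of_eq ((hX 0).mul ((hX 1).pow 5)) (show _ = (6 : ℤ) by simp)) (by norm_num)))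
      (lt_weight_of_isWeightedHomogeneous (isWeightedHomogeneous_of_eq (((hX 1).pow 6).mul ((hX 0).pow 10)) (show _ = (16 : ℤ) by simp)) (by norm_num)))
      (lt_weight_of_isWeightedHomogeneous (isWeightedHomogeneous_of_eq ((hX 1).pow 6) (show _ = (6 : ℤ) by simp)) (by norm_num)))
      (lt_weight_of_isWeightedHomogeneous (isWeightedHomogeneous_of_eq (((hX 1).pow 6).mul ((hX 2).pow 10)) (show _ = (16 : ℤ) by simp)) (by norm_num))
  have hF : s10F1 k = (X 0 ^ 2 + X 1 * X 2) ^ 2 +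
      (X 0 ^ 5 * X 1 + X 2 ^ 6 * X 1 ^ 2 + X 0 * X 1 ^ 5 + X 1 ^ 6 * X 0 ^ 10 + X 1 ^ 6 + X 1 ^ 6 * X 2 ^ 10) := by
    simp only [s10F1]; ring
  have hP0 : ((X 0 ^ 2 + X 1 * X 2) ^ 2 : MvPolynomial (Fin 3) k) ≠ 0 := ne_zero_of_eval_ne_zero ![(1 : k), 0, 0] (by simp)
  exact initialForm_eq_of_split _ hF hP hR hP0

/-- (S2) **The germ of `H₁` at `q` is NOT locally Newton-nondegenerate** (in the chart frame): weight `(1,1,1)`, initial form `(x₁² + y₁z₁)²`, torus point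
`(1, 1, −1)`. [OURS · L1 W4.5b · degenerate-face certificate] -/
theorem not_isLocallyNewtonNondegenerate_s10F1 : ¬ IsLocallyNewtonNondegenerate (s10F1 k) := by
  intro h
  have hQ : eval ![(1 : k), 1, -1] ((X 0 ^ 2 + X 1 * X 2) : MvPolynomial (Fin 3) k) = 0 := by simp
  refine h ![(1 : ℤ), 1, 1] (by decide) ![(1 : k), 1, -1] (fun i => by fin_cases i <;> simp) ?_ ?_
  · rw [initialForm_ones_s10F1, map_pow, hQ]; norm_num
  · intro i; rw [initialForm_ones_s10F1]; exact eval_pderiv_sq_eq_zero _ _ hQ i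


/-! ## D. (§4(ii), appended) The NEST stage: blow-up of the conic `Γ_q`, chart `u = u′y` in coordinates `(x, y, u := x² + z)`; the quintic `x⁵ + x + 1`

APPEND (res-L1-w45b-iso-w3 g0, 2026-08-28, after FINDING STATUS 18:23Z): along `Γ_q` the transversal type of `Bl_q H₁` is `u² + (x⁵ + x + 1)·y²`; after the
NEST round `Bl_{Γ_q}` the strict transform restricted to `E_Γ` is `u′² + x⁵ + x + 1`, and `x⁵ + x + 1 = (x² + x + 1)(x³ − x² + 1)` over `ℤ` (discriminant
`−3 · 7² · (−23)`): wherever this quintic has a double root mod `p` — `p ∈ {3, 7, 23}` — the strict transform has an ordinary double point ON `E_Γ`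
(certified below for `p = 3` at `(x, y, u′) = (1, 0, 0)`), so the 7-move NEST schedule of the memo needs one more point step (or an ND leaf) there. -/

variable (k) in
/-- Chart `u = u′y` of `Bl_{Γ_q}` (coordinates `(x, y, u′)`; `z = u′y − x²`, exceptional `y`, multiplicity 2): the strict transform `F_Γ` of `F_q`.
[OURS · L1 W4.5b · specimen object] -/
def s10FGamma : MvPolynomial (Fin 3) k :=
  X 2 ^ 2 + X 0 ^ 5 + X 0 + 1 + (X 2 * X 1 - X 0 ^ 2) ^ 6 * X 1 ^ 2 + X 0 ^ 10 * X 1 ^ 10 + (X 2 * X 1 - X 0 ^ 2) ^ 10 * X 1 ^ 10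

/-- **NEST chart**: `F_q(x, y, u′y − x²) = y² · F_Γ`. [OURS · L1 W4.5b] -/
theorem aeval_chartNest_s10Fq :
    aeval ![X 0, X 1, X 2 * X 1 - X 0 ^ 2] (s10Fq k) = X 1 ^ 2 * s10FGamma k := by
  simp only [s10Fq, s10FGamma, map_add, map_mul, map_pow, aeval_X, Matrix.cons_val_zero, Matrix.cons_val_one, Matrix.head_cons,
    Matrix.cons_val_two, Matrix.tail_cons]
  ring

/-- The transversal type of `Bl_q H₁` along `Γ_q`: in the coordinates `(x, y, u := x² + z)`, `F_q = u² + y²·C(x, y, u − x²)` with `C(x, 0, −x²) = x⁵ + x + 1`.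
[OURS · L1 W4.5b] -/
theorem aeval_s10Fq_u_coords :
    aeval ![(X 0 : MvPolynomial (Fin 3) k), X 1, X 2 - X 0 ^ 2] (s10Fq k) = X 2 ^ 2 + X 1 ^ 2 *
      (X 0 ^ 5 + (X 2 - X 0 ^ 2) ^ 6 * X 1 ^ 2 + X 0 + 1 + X 0 ^ 10 * X 1 ^ 10 + (X 2 - X 0 ^ 2) ^ 10 * X 1 ^ 10) := by
  simp only [s10Fq, map_add, map_mul, map_pow, aeval_X, Matrix.cons_val_zero, Matrix.cons_val_one, Matrix.head_cons,
    Matrix.cons_val_two, Matrix.tail_cons]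
  ring

/-- **`F_Γ` restricted to the exceptional divisor `E_Γ = {y = 0}` is `u′² + x⁵ + x + 1`.** [OURS · L1 W4.5b] -/
theorem aeval_s10FGamma_restrict :
    aeval ![(X 0 : MvPolynomial (Fin 3) k), 0, X 2] (s10FGamma k) = X 2 ^ 2 + X 0 ^ 5 + X 0 + 1 := by
  simp only [s10FGamma, map_add, map_mul, map_pow, map_one, aeval_X, Matrix.cons_val_zero, Matrix.cons_val_one, Matrix.head_cons,
    Matrix.cons_val_two, Matrix.tail_cons]
  ring

/-- **The quintic factors over `ℤ`: `x⁵ + x + 1 = (x² + x + 1)(x³ − x² + 1)`** (so its discriminant is `−3 · 7² · (−23)`, and double roots mod `p` occur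
exactly at `p ∈ {3, 7, 23}`: `x ≡ 1 (3)`, `x ≡ 4 (7)`, `x ≡ 16 (23)`). [OURS · L1 W4.5b · arithmetic] -/
theorem quintic_factor_s10 : (X 0 ^ 5 + X 0 + 1 : MvPolynomial (Fin 3) k) = (X 0 ^ 2 + X 0 + 1) * (X 0 ^ 3 - X 0 ^ 2 + 1) := by
  ring

/-- **Characteristic 3: an extra singular point ON `E_Γ`.** If `3 = 0` in `k`, then `F_Γ` and all its partial derivatives vanish at `(x, y, u′) = (1, 0, 0)`
(an ordinary double point of the strict transform after the NEST round: local form `u′² + (x−1)²·unit + y²·unit`). [OURS · L1 W4.5b] -/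
theorem s10FGamma_singular_point_char3 (h3 : (3 : k) = 0) :
    eval ![(1 : k), 0, 0] (s10FGamma k) = 0 ∧ ∀ i, eval ![(1 : k), 0, 0] (pderiv i (s10FGamma k)) = 0 := by
  have h6 : (6 : k) = 0 := by linear_combination (2 : k) * h3
  refine ⟨?_, fun i => ?_⟩
  · simp [s10FGamma]
    linear_combination h3
  · fin_cases i
    · simp [s10FGamma, Derivation.leibniz, Derivation.leibniz_pow, pderiv_X]
      linear_combination h6
    · simp [s10FGamma, Derivation.leibniz, Derivation.leibniz_pow, pderiv_X]
    · simp [s10FGamma, Derivation.leibniz, Derivation.leibniz_pow, pderiv_X]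


/-! ## E. (R41″ (β2), appended) The branch `P · incpt(q) · carrier(L̃)`: chart Eq1.z of `Bl_q`, then the two charts of `Bl_{L̃}` — the strict transform `Γ̃_q` of
## the conic stays a whole SINGULAR CURVE of the strict transform (confirms res-L1-w45b-iso-w1's (N4), `BETA1-FINDING.md` 7d0c35cd3aebf0cc; FINDING STATUS 18:50Z)

APPEND (res-L1-w45b-iso-w3 g0, 2026-08-28). In chart Eq1.z (`x₁ = xz, y₁ = yz, z₁ = z`, exceptional `z`, multiplicity 4) the conic is `Γ_q = {z = 0, x² + y = 0}` and
the carrier is `L̃ = {x = y = 0}`, meeting at `q₁ = 0`. After the carrier round `Bl_{L̃}` (charts C: `y = y′x`, C′: `x = x′y`) the strict transform is `(x + y′)² + z²·R`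
resp. `(x′²y + 1)² + z²·R′`: singular along ALL of `Γ̃_q`, and its trace on `St E_q = {z = 0}` is the DOUBLE curve `2Γ̃_q` — no point of the strict transform over `q₁`
or on `St E_q` is an isolated non-regular point, and the tangent cone at any point of `Γ̃_q` involves only `u = x + y′` and `z` (rank ≤ 2: never a smooth conic). -/

variable (k) in
/-- Chart Eq1.z of the point blow-up at `q`: the strict transform `F_qz` of `F₁` (`Γ_q = {z = 0, x² + y = 0}`, `L̃ = {x = y = 0}`). [OURS · L1 W4.5b · specimen object] -/
def s10Fqz : MvPolynomial (Fin 3) k :=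
  (X 0 ^ 2 + X 1) ^ 2 + X 0 ^ 5 * X 1 * X 2 ^ 2 + X 1 ^ 2 * X 2 ^ 4 + X 0 * X 1 ^ 5 * X 2 ^ 2 + X 1 ^ 6 * X 2 ^ 2 * (X 0 ^ 10 * X 2 ^ 10 + 1 + X 2 ^ 10)

variable (k) in
/-- Chart C (`y = y′x`, exceptional `x`, multiplicity 2) of the carrier round `Bl_{L̃}` after `incpt(q)`: the strict transform `F_c`. [OURS · L1 W4.5b · specimen object] -/
def s10Fc : MvPolynomial (Fin 3) k :=
  (X 0 + X 1) ^ 2 + X 2 ^ 2 * (X 1 ^ 2 * X 2 ^ 2 + X 0 ^ 4 * X 1 + X 0 ^ 4 * X 1 ^ 5 + X 0 ^ 4 * X 1 ^ 6 + X 0 ^ 4 * X 1 ^ 6 * X 2 ^ 10 + X 0 ^ 14 * X 1 ^ 6 * X 2 ^ 10)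

variable (k) in
/-- Chart C′ (`x = x′y`, exceptional `y`, multiplicity 2) of the carrier round `Bl_{L̃}` after `incpt(q)`: the strict transform `F_c′`. [OURS · L1 W4.5b · specimen object] -/
def s10Fc' : MvPolynomial (Fin 3) k :=
  (X 0 ^ 2 * X 1 + 1) ^ 2 + X 2 ^ 2 * (X 2 ^ 2 + X 1 ^ 4 + X 1 ^ 4 * X 2 ^ 10 + X 0 * X 1 ^ 4 + X 0 ^ 5 * X 1 ^ 4 + X 0 ^ 10 * X 1 ^ 14 * X 2 ^ 10)

/-- **Eq1.z**: `F₁(xz, yz, z) = z⁴ · F_qz`. [OURS · L1 W4.5b] -/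
theorem aeval_chartEq1z_s10F1 :
    aeval ![X 0 * X 2, X 1 * X 2, X 2] (s10F1 k) = X 2 ^ 4 * s10Fqz k := by
  simp only [s10F1, s10Fqz, map_add, map_mul, map_pow, map_one, aeval_X, Matrix.cons_val_zero, Matrix.cons_val_one, Matrix.head_cons,
    Matrix.cons_val_two, Matrix.tail_cons]
  ring

/-- `F_qz = C·(x² + y)² + A·z²` explicitly: `Bl_q H₁` is singular along the conic `Γ_q` in this chart too. [OURS · L1 W4.5b] -/
theorem s10Fqz_decomp_conic : s10Fqz k = (X 0 ^ 5 * X 1 + X 1 ^ 2 * X 2 ^ 2 + X 0 * X 1 ^ 5 + X 1 ^ 6 * (X 0 ^ 10 * X 2 ^ 10 + 1 + X 2 ^ 10)) * X 2 ^ 2 +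
    0 * (X 2 * (X 0 ^ 2 + X 1)) + 1 * (X 0 ^ 2 + X 1) ^ 2 := by
  simp only [s10Fqz]; ring

/-- **`F_qz ∈ (z, x² + y)²`** (singular along `Γ_q`). [OURS · L1 W4.5b] -/
theorem s10Fqz_mem_sq_conic : s10Fqz k ∈ (Ideal.span {(X 2 : MvPolynomial (Fin 3) k), X 0 ^ 2 + X 1}) ^ 2 :=
  mem_sq_span_pair_of_decomp s10Fqz_decomp_conic

/-- `F_qz = A·x² + B·xy + C·y²` explicitly: the carrier `L̃ = {x = y = 0}` is still a double curve. [OURS · L1 W4.5b] -/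
theorem s10Fqz_decomp_carrier : s10Fqz k = (X 0 ^ 2 + 2 * X 1 + X 0 ^ 3 * X 1 * X 2 ^ 2) * X 0 ^ 2 + (X 1 ^ 4 * X 2 ^ 2) * (X 0 * X 1) +
    (1 + X 2 ^ 4 + X 1 ^ 4 * X 2 ^ 2 * (X 0 ^ 10 * X 2 ^ 10 + 1 + X 2 ^ 10)) * X 1 ^ 2 := by
  simp only [s10Fqz]; ring

/-- **`F_qz ∈ (x, y)²`** (singular along the carrier `L̃`, multiplicity 2). [OURS · L1 W4.5b] -/
theorem s10Fqz_mem_sq_carrier : s10Fqz k ∈ (Ideal.span {(X 0 : MvPolynomial (Fin 3) k), X 1}) ^ 2 :=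
  mem_sq_span_pair_of_decomp s10Fqz_decomp_carrier

/-- **Carrier chart C**: `F_qz(x, y′x, z) = x² · F_c`. [OURS · L1 W4.5b] -/
theorem aeval_chartC_s10Fqz :
    aeval ![X 0, X 1 * X 0, X 2] (s10Fqz k) = X 0 ^ 2 * s10Fc k := by
  simp only [s10Fqz, s10Fc, map_add, map_mul, map_pow, map_one, aeval_X, Matrix.cons_val_zero, Matrix.cons_val_one, Matrix.head_cons,
    Matrix.cons_val_two, Matrix.tail_cons]
  ring

/-- `F_c = A·z² + 1·(x + y′)²` explicitly. [OURS · L1 W4.5b] -/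
theorem s10Fc_decomp : s10Fc k = (X 1 ^ 2 * X 2 ^ 2 + X 0 ^ 4 * X 1 + X 0 ^ 4 * X 1 ^ 5 + X 0 ^ 4 * X 1 ^ 6 + X 0 ^ 4 * X 1 ^ 6 * X 2 ^ 10 +
    X 0 ^ 14 * X 1 ^ 6 * X 2 ^ 10) * X 2 ^ 2 + 0 * (X 2 * (X 0 + X 1)) + 1 * (X 0 + X 1) ^ 2 := by
  simp only [s10Fc]; ring

/-- **(β2) `F_c ∈ (z, x + y′)²`: after `P · incpt(q) · carrier(L̃)` the strict transform is SINGULAR along the whole strict transform `Γ̃_q = {z = 0, x + y′ = 0}`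
of the conic.** [OURS · L1 W4.5b] -/
theorem s10Fc_mem_sq : s10Fc k ∈ (Ideal.span {(X 2 : MvPolynomial (Fin 3) k), X 0 + X 1}) ^ 2 :=
  mem_sq_span_pair_of_decomp s10Fc_decomp

/-- (β2), Jacobian form: `F_c` and `∇F_c` vanish at every point of `Γ̃_q`. [OURS · L1 W4.5b] -/
theorem s10Fc_singular_along_conic (v : Fin 3 → k) (h2 : v 2 = 0) (h01 : v 0 + v 1 = 0) :
    eval v (s10Fc k) = 0 ∧ ∀ i, eval v (pderiv i (s10Fc k)) = 0 :=
  eval_and_pderiv_eq_zero_of_decomp s10Fc_decomp v (by simp [h2]) (by simp [h01])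

/-- **The trace of the strict transform on `St E_q = {z = 0}` is the DOUBLE curve `2Γ̃_q`**: `F_c(x, y′, 0) = (x + y′)²` (so no point over `q₁` / on `St E_q` is an
isolated non-regular point). [OURS · L1 W4.5b] -/
theorem aeval_s10Fc_restrict_StEq : aeval ![(X 0 : MvPolynomial (Fin 3) k), X 1, 0] (s10Fc k) = (X 0 + X 1) ^ 2 := by
  simp only [s10Fc, map_add, map_mul, map_pow, aeval_X, Matrix.cons_val_zero, Matrix.cons_val_one, Matrix.head_cons,
    Matrix.cons_val_two, Matrix.tail_cons]
  ring

/-- **Carrier chart C′**: `F_qz(x′y, y, z) = y² · F_c′`. [OURS · L1 W4.5b] -/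
theorem aeval_chartC'_s10Fqz :
    aeval ![X 0 * X 1, X 1, X 2] (s10Fqz k) = X 1 ^ 2 * s10Fc' k := by
  simp only [s10Fqz, s10Fc', map_add, map_mul, map_pow, map_one, aeval_X, Matrix.cons_val_zero, Matrix.cons_val_one, Matrix.head_cons,
    Matrix.cons_val_two, Matrix.tail_cons]
  ring

/-- `F_c′ = A·z² + 1·(x′²y + 1)²` explicitly. [OURS · L1 W4.5b] -/
theorem s10Fc'_decomp : s10Fc' k = (X 2 ^ 2 + X 1 ^ 4 + X 1 ^ 4 * X 2 ^ 10 + X 0 * X 1 ^ 4 + X 0 ^ 5 * X 1 ^ 4 + X 0 ^ 10 * X 1 ^ 14 * X 2 ^ 10) * X 2 ^ 2 +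
    0 * (X 2 * (X 0 ^ 2 * X 1 + 1)) + 1 * (X 0 ^ 2 * X 1 + 1) ^ 2 := by
  simp only [s10Fc']; ring

/-- **(β2) `F_c′ ∈ (z, x′²y + 1)²`**: in the other carrier chart the strict transform is singular along `Γ̃_q = {z = 0, x′²y + 1 = 0}` as well. [OURS · L1 W4.5b] -/
theorem s10Fc'_mem_sq : s10Fc' k ∈ (Ideal.span {(X 2 : MvPolynomial (Fin 3) k), X 0 ^ 2 * X 1 + 1}) ^ 2 :=
  mem_sq_span_pair_of_decomp s10Fc'_decomp

end Summit.ResolutionOfSingularities.ResolutionOfSingularities.Cruxes.EquisingularLiftNat.Sections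

end
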